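import Literature.Analysis.Complex.CauchyTransformBounds
import Literature.Analysis.Complex.DbarAlongHolomorphic
import Literature.Analysis.Complex.SeveralVariables
import Mathlib.Analysis.SpecialFunctions.SmoothTransition
import HarnessLib

/-!
# Cousin's Heftungslemma with bounds (Grauert–Remmert, Kap. III §1.1, Satz 1)

Grauert–Remmert, *Theorie der Steinschen Räume* (1977), Kap. III §1 Nr. 1 ("Lemma von Cousin"):
in `ℂᵐ` with `z₁ = x + iy` distinguished, let `E = {a < x < b, c < y < d}`, `a < a' < b' < b`,
`E' = {z₁ ∈ E : x < b'}`, `E'' = {z₁ ∈ E : a' < x}`, `U` open in the remaining variables,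
`B' = E' × U`, `B'' = E'' × U`, `D = B' ∩ B''`. **Satz 1** (Cousinsches Heftungslemma): there is
a constant `K` such that every bounded holomorphic `f` on `D` splits as `f = f'|D + f''|D` with
`f'`, `f''` bounded holomorphic on `B'`, `B''` and `|f'|_{B'} ≤ K|f|_D`, `|f''|_{B''} ≤ K|f|_D`.
GR's proof: with a `C^∞` cutoff `r(x)` (`= 0` for `x < a' + δ`, `= 1` for `x > b' − δ`) put
`p = r f` on `B'`, `q = (1 − r) f` on `B''`, `h = ½ r'(x) f` on `B`; solve `∂ĥ/∂z̄₁ = h` with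
`|ĥ| ≤ 2ρ|h|` (Kap. II §3) and set `f' = p − ĥ`, `f'' = q + ĥ`.

We prove the lemma in the following form (`cousin_heftung`), on `ℂ × P` for an arbitrary complex
normed space `P` of "remaining variables" and a complete target space `F`:

* the `∂̄`-equation is solved by the Cauchy transform along `e₁ = (1, 0)` of the tree
  (`Literature.Analysis.Complex.cauchyTransformAlong`, Hörmander Thm. 1.2.2, which needs GLOBAL
  compactly supported data), so `h` is additionally cut off in `y` and in the parameters:
  `h = (½ r'(x) χ₂(y) χ₃(z')) • f` with `χ₂ = 1` on `[c + 2ε, d − 2ε]` (built from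
  `Real.smoothTransition`, like `r`) and a parameter cutoff `χ₃` (`C¹`, compactly supported in
  `U`, `= 1` on an open `U₁`, `|χ₃| ≤ 1`) SUPPLIED BY THE CALLER (for `U` a polydisc of `ℂⁿ` the
  tree's `exists_polydisc_cutoff` provides it);
* accordingly the conclusion is the splitting `f = f' + f''` with `f'`, `f''` holomorphic on the
  SHRUNKEN boxes `B'₁ = {x < b', c + 2ε < y < d − 2ε} × U₁`, `B''₁ = {a' < x, …} × U₁`, and the
  bounds `‖f'‖ ≤ K‖f‖_D` on `{a < x < b', c < y < d} × P`, `‖f''‖ ≤ K‖f‖_D` on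
  `{a' < x < b, c < y < d} × P`, with `K = 1 + R M / L` depending only on the geometry
  (`L = b' − a' − 2δ`, `R = (b − a) + Δ + 1` for `|d − c| ≤ Δ`, `M = sup |smoothTransition'|`),
  uniform in `c, d, ε` — which is what the iteration in Cartan's lemma needs.

This shrunken form is what iterations on nested boxes consume (Cartan's Heftungslemma, loc. cit.
§1.3). Ingredients: `norm_cauchyTransformAlong_le` (the estimate `|ĥ| ≤ 2ρ|h|`),
`dbarAlong_cauchyTransformAlong` (`∂̄₁ĥ = h`), `dbarAlong_cauchyTransformAlong_eq_zero`
(holomorphy in the parameters), the Leibniz rule `dbarAlong_smul`, and the Cauchy–Riemann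
criterion `differentiableAt_complex_iff_dbarAlong_eq_zero`, here split into the `z₁`-direction
and the parameter directions (`dbarAlong_prod_dir`).

## References

* H. Grauert, R. Remmert, *Theorie der Steinschen Räume*, Grundlehren 227 (1977), Kap. III §1.1,
  Satz 1 (Cousinsches Heftungslemma) and its proof [GrauertRemmert1977].
* L. Hörmander, *An Introduction to Complex Analysis in Several Variables* (1973), Thm. 1.2.2.
-/

noncomputable section

open Complex Metric Set Filter
open scoped Topology ComplexConjugate ContDiff

namespace Literature.Analysis.Complex

/-! ### The derivative of `Real.smoothTransition` -/

/-- `smoothTransition' = 0` off `[0, 1]`: the function is `0` on `(-∞, 0]` and `1` on `[1, ∞)`,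
hence locally constant off `[0, 1]`. (Private: the same elementary fact is proved in several
unrelated files of the tree — e.g. `Literature.Analysis.FluidPDE.deriv_smoothTransition_eq_zero`,
`Literature.Geometry.Lorentzian.deriv_smoothTransition_eq_zero_of_one_lt` — whose imports do not
belong in complex analysis.) [folklore] -/
private theorem deriv_smoothTransition_eq_zero_of_notMem_Icc {x : ℝ} (hx : x ∉ Icc (0 : ℝ) 1) :
    deriv Real.smoothTransition x = 0 := by
  rcases lt_or_ge x 0 with h | h
  · have he : Real.smoothTransition =ᶠ[𝓝 x] fun _ ↦ (0 : ℝ) :=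
      (eventually_lt_nhds h).mono fun y hy ↦ Real.smoothTransition.zero_of_nonpos hy.le
    rw [he.deriv_eq, deriv_const]
  · have h1 : 1 < x := lt_of_not_ge fun h1 ↦ hx ⟨h, h1⟩
    have he : Real.smoothTransition =ᶠ[𝓝 x] fun _ ↦ (1 : ℝ) :=
      (eventually_gt_nhds h1).mono fun y hy ↦ Real.smoothTransition.one_of_one_le hy.le
    rw [he.deriv_eq, deriv_const]

/-- `smoothTransition'` is `C^∞`. [folklore] -/
private theorem contDiff_deriv_smoothTransition {n : ℕ} : ContDiff ℝ n (deriv Real.smoothTransition) :=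
  contDiff_infty.1 (contDiff_infty_iff_deriv.1 Real.smoothTransition.contDiff).2 n

/-- `smoothTransition'` is bounded: `M = sup |smoothTransition'| < ∞` (it is continuous and
vanishes off `[0, 1]`). (Private, for the same reason as above; cf.
`Literature.MathematicalPhysics.QuantumManyBody.exists_bound_deriv_smoothTransition`.) [folklore] -/
private theorem exists_bound_deriv_smoothTransition :
    ∃ M : ℝ, 0 ≤ M ∧ ∀ x, |deriv Real.smoothTransition x| ≤ M := by
  have hc : Continuous (deriv Real.smoothTransition) :=
    (contDiff_deriv_smoothTransition (n := 0)).continuous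
  have hs : HasCompactSupport (deriv Real.smoothTransition) :=
    HasCompactSupport.intro (K := Icc 0 1) isCompact_Icc fun x hx ↦
      deriv_smoothTransition_eq_zero_of_notMem_Icc hx
  obtain ⟨C, hC⟩ := hc.bounded_above_of_compact_support hs
  exact ⟨max C 0, le_max_right _ _, fun x ↦ (Real.norm_eq_abs _ ▸ hC x).trans (le_max_left _ _)⟩

/-! ### `∂̄` on `ℂ × P`: the `z₁`-direction and the parameter directions -/

section Prod

variable {P : Type*} [NormedAddCommGroup P] [NormedSpace ℂ P]
  {F : Type*} [NormedAddCommGroup F] [NormedSpace ℂ F]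

/-- Derivative of `z ↦ g(Re z₁)` on `ℂ × P` for a differentiable `g : ℝ → ℝ` (chain rule through
the real-linear maps `z ↦ z₁ ↦ Re z₁` and `ℝ ↪ ℂ`). [folklore] -/
theorem hasFDerivAt_ofReal_re_fst {g : ℝ → ℝ} {g' : ℝ} {z : ℂ × P} (hg : HasDerivAt g g' z.1.re) :
    HasFDerivAt (fun w : ℂ × P ↦ ((g w.1.re : ℝ) : ℂ))
      (ofRealCLM.comp ((ContinuousLinearMap.smulRight (1 : ℝ →L[ℝ] ℝ) g').comp
        (reCLM.comp (ContinuousLinearMap.fst ℝ ℂ P)))) z :=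
  ofRealCLM.hasFDerivAt.comp z
    (hg.hasFDerivAt.comp z (reCLM.comp (ContinuousLinearMap.fst ℝ ℂ P)).hasFDerivAt)

/-- `∂̄` in the `z₁`-direction of `z ↦ g(Re z₁)` is `½ g'(Re z₁)` (`∂/∂z̄ = ½(∂ₓ + i∂_y)` and the
function does not depend on `y`). [folklore] -/
theorem dbarAlong_e1_ofReal_re_fst {g : ℝ → ℝ} {g' : ℝ} {z : ℂ × P}
    (hg : HasDerivAt g g' z.1.re) :
    dbarAlong ((1 : ℂ), (0 : P)) (fun w : ℂ × P ↦ ((g w.1.re : ℝ) : ℂ)) z = (g' : ℂ) / 2 := by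
  rw [dbarAlong_apply, (hasFDerivAt_ofReal_re_fst hg).fderiv]
  simp [div_eq_inv_mul]

/-- A function of `z₁` alone has `∂̄ = 0` in every parameter direction `(0, w)`. [folklore] -/
theorem dbarAlong_zero_dir_eq_zero_of_fst {F' : Type*} [NormedAddCommGroup F'] [NormedSpace ℂ F']
    (G : ℂ → F') (w : P) (z : ℂ × P) :
    dbarAlong ((0 : ℂ), w) (fun u : ℂ × P ↦ G u.1) z = 0 :=
  dbarAlong_eq_zero_of_eventually_eq (Eventually.of_forall fun τ ↦ by simp)

/-- Decomposition of `∂̄_v` on `ℂ × P` into the `z₁`-direction and a parameter direction: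
`∂̄_{(v₁, v₂)} = v̄₁ ∂̄_{(1,0)} + ∂̄_{(0,v₂)}` (conjugate-linearity in the direction). [folklore] -/
theorem dbarAlong_prod_dir (v : ℂ × P) (u : ℂ × P → F) (z : ℂ × P) :
    dbarAlong v u z =
      conj v.1 • dbarAlong ((1 : ℂ), (0 : P)) u z + dbarAlong ((0 : ℂ), v.2) u z := by
  have hv : v = v.1 • ((1 : ℂ), (0 : P)) + ((0 : ℂ), v.2) := by ext <;> simp
  conv_lhs => rw [hv]
  rw [dbarAlong_add_left, dbarAlong_smul_left]

/-- **Cauchy–Riemann on `ℂ × P`**: a real-differentiable `u` with `∂̄_{(1,0)} u = 0` and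
`∂̄_{(0,w)} u = 0` for all `w` at `z` is complex-differentiable at `z`.
[cite: HormanderSCV1973, §2.1] -/
theorem differentiableAt_complex_of_dbarAlong_prod {u : ℂ × P → F} {z : ℂ × P}
    (hu : DifferentiableAt ℝ u z) (h1 : dbarAlong ((1 : ℂ), (0 : P)) u z = 0)
    (h2 : ∀ w : P, dbarAlong ((0 : ℂ), w) u z = 0) : DifferentiableAt ℂ u z :=
  (differentiableAt_complex_iff_dbarAlong_eq_zero hu).2 fun v ↦ by
    rw [dbarAlong_prod_dir, h1, h2, smul_zero, zero_add]

end Prod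

/-! ### Cousin's Heftungslemma -/

section Cousin

variable {P : Type*} [NormedAddCommGroup P] [NormedSpace ℂ P]
  {F : Type*} [NormedAddCommGroup F] [NormedSpace ℂ F] [CompleteSpace F]

omit [NormedSpace ℂ P] in
/-- The boxes `{α < x < β, γ < y < η} × U` of `ℂ × P` are open. [folklore] -/
private theorem isOpen_box (α β γ η : ℝ) {U : Set P} (hU : IsOpen U) :
    IsOpen {z : ℂ × P | α < z.1.re ∧ z.1.re < β ∧ γ < z.1.im ∧ z.1.im < η ∧ z.2 ∈ U} := by
  have hre : Continuous fun z : ℂ × P ↦ z.1.re := continuous_re.comp continuous_fst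
  have him : Continuous fun z : ℂ × P ↦ z.1.im := continuous_im.comp continuous_fst
  simp only [setOf_and]
  exact (isOpen_lt continuous_const hre).inter ((isOpen_lt hre continuous_const).inter
    ((isOpen_lt continuous_const him).inter ((isOpen_lt him continuous_const).inter
    (hU.preimage continuous_snd))))

/-- **Cousin's Heftungslemma with bounds (Grauert–Remmert, Kap. III §1.1, Satz 1), shrunken
form.** Fix the `x`-geometry `a ≤ a' < a' + δ < b' − δ < b' ≤ b` and a bound `Δ` for the height
`|d − c|`. There is a constant `K ≥ 0` (uniform in `c, d, ε`, as needed for iterations) such that: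
for all `c, d` with `|d − c| ≤ Δ`, `ε > 0`, every holomorphic `f` on
`D = {a' < x < b', c < y < d} × U` (`U ⊆ P` open) bounded by `N`, and every `C¹` compactly
supported parameter cutoff `χ₃` with
`tsupport χ₃ ⊆ U`, `χ₃ = 1` on the open `U₁` and `|χ₃| ≤ 1`, there are `f'`, `f''` with
`f'` holomorphic on `B'₁ = {x < b', c + 2ε < y < d − 2ε} × U₁`, `f''` holomorphic on
`B''₁ = {a' < x, c + 2ε < y < d − 2ε} × U₁`, `f = f' + f''` on `B'₁ ∩ B''₁`, and
`‖f'‖ ≤ K N` on `{a < x < b', c < y < d} × P`, `‖f''‖ ≤ K N` on `{a' < x < b, c < y < d} × P`.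
(GR: `f' = r f − ĥ`, `f'' = (1 − r) f + ĥ`, `∂ĥ/∂z̄₁ = ½ r' f`; here `ĥ` is the Cauchy transform
along `e₁` of `(½ r'(x) χ₂(y) χ₃(z')) • f`.)
[cite: GrauertRemmert1977, Kap. III §1.1 Satz 1] -/
theorem cousin_heftung {a a' b' b δ Δ : ℝ} (haa' : a ≤ a') (hb'b : b' ≤ b) (hδ : 0 < δ)
    (hab : a' + δ < b' - δ) (hΔ0 : 0 ≤ Δ) :
    ∃ K : ℝ, 0 ≤ K ∧ ∀ (c d ε : ℝ) (f : ℂ × P → F) (U U₁ : Set P) (χ₃ : P → ℂ) (N : ℝ),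
      |d - c| ≤ Δ → 0 < ε →
      IsOpen U → IsOpen U₁ → ContDiff ℝ 1 χ₃ → HasCompactSupport χ₃ → tsupport χ₃ ⊆ U →
      (∀ p ∈ U₁, χ₃ p = 1) → (∀ p, ‖χ₃ p‖ ≤ 1) → 0 ≤ N →
      DifferentiableOn ℂ f
        {z : ℂ × P | a' < z.1.re ∧ z.1.re < b' ∧ c < z.1.im ∧ z.1.im < d ∧ z.2 ∈ U} →
      (∀ z : ℂ × P, a' < z.1.re → z.1.re < b' → c < z.1.im → z.1.im < d → z.2 ∈ U →
        ‖f z‖ ≤ N) →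
      ∃ f' f'' : ℂ × P → F,
        DifferentiableOn ℂ f'
          {z : ℂ × P | z.1.re < b' ∧ c + 2 * ε < z.1.im ∧ z.1.im < d - 2 * ε ∧ z.2 ∈ U₁} ∧
        DifferentiableOn ℂ f''
          {z : ℂ × P | a' < z.1.re ∧ c + 2 * ε < z.1.im ∧ z.1.im < d - 2 * ε ∧ z.2 ∈ U₁} ∧
        (∀ z : ℂ × P, a' < z.1.re → z.1.re < b' → c + 2 * ε < z.1.im → z.1.im < d - 2 * ε →
          z.2 ∈ U₁ → f z = f' z + f'' z) ∧
        (∀ z : ℂ × P, a < z.1.re → z.1.re < b' → c < z.1.im → z.1.im < d → ‖f' z‖ ≤ K * N) ∧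
        (∀ z : ℂ × P, a' < z.1.re → z.1.re < b → c < z.1.im → z.1.im < d → ‖f'' z‖ ≤ K * N) := by
  obtain ⟨M, hM0, hM⟩ := exists_bound_deriv_smoothTransition
  -- the geometry constants
  set L : ℝ := b' - δ - (a' + δ) with hL
  have hL0 : 0 < L := by rw [hL]; linarith
  set R : ℝ := (b - a) + Δ + 1 with hR
  have hR0 : 0 < R := by rw [hR]; linarith
  refine ⟨1 + R * M / L, by positivity, ?_⟩
  intro c d ε f U U₁ χ₃ N hΔ hε hU hU₁ hχd hχc hχU hχ1 hχle hN hf hfN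
  -- notation
  set e₁ : ℂ × P := ((1 : ℂ), (0 : P)) with he₁
  have he₁0 : e₁ ≠ 0 := by simp [he₁]
  set D : Set (ℂ × P) :=
    {z : ℂ × P | a' < z.1.re ∧ z.1.re < b' ∧ c < z.1.im ∧ z.1.im < d ∧ z.2 ∈ U} with hDdef
  have hDo : IsOpen D := isOpen_box a' b' c d hU
  have hU₁U : U₁ ⊆ U := fun p hp ↦
    hχU (subset_tsupport _ (by simp [Function.mem_support, hχ1 p hp]))
  -- the cut-off functions
  set r : ℂ × P → ℂ := fun z ↦ ((Real.smoothTransition ((z.1.re - (a' + δ)) / L) : ℝ) : ℂ) with hr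
  set ρ : ℂ × P → ℝ := fun z ↦ deriv Real.smoothTransition ((z.1.re - (a' + δ)) / L) / L with hρ
  set χ₂ : ℂ × P → ℝ := fun z ↦ Real.smoothTransition ((z.1.im - c - ε) / ε) * Real.smoothTransition ((d - ε - z.1.im) / ε) with hχ₂
  set θ : ℂ × P → ℂ := fun z ↦ ((ρ z * χ₂ z / 2 : ℝ) : ℂ) * χ₃ z.2 with hθ
  set h : ℂ × P → F := fun z ↦ θ z • f z with hh
  set T : ℂ × P → F := cauchyTransformAlong e₁ h with hT
  set p : ℂ × P → F := fun z ↦ (r z * (χ₂ z : ℂ) * χ₃ z.2) • f z with hp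
  set q : ℂ × P → F := fun z ↦ ((1 - r z) * (χ₂ z : ℂ) * χ₃ z.2) • f z with hq
  /- smoothness of the cut-offs -/
  have hS1 : ContDiff ℝ 1 Real.smoothTransition := by
    exact_mod_cast Real.smoothTransition.contDiff (n := 1)
  have hS'1 : ContDiff ℝ 1 (deriv Real.smoothTransition) := by
    exact_mod_cast contDiff_deriv_smoothTransition (n := 1)
  have hcre : ContDiff ℝ 1 fun z : ℂ × P ↦ z.1.re := reCLM.contDiff.comp contDiff_fst
  have hcim : ContDiff ℝ 1 fun z : ℂ × P ↦ z.1.im := imCLM.contDiff.comp contDiff_fst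
  have hcu : ContDiff ℝ 1 fun z : ℂ × P ↦ (z.1.re - (a' + δ)) / L :=
    (hcre.sub contDiff_const).div_const L
  have hrd : ContDiff ℝ 1 r := ofRealCLM.contDiff.comp (hS1.comp hcu)
  have hρd : ContDiff ℝ 1 ρ := (hS'1.comp hcu).div_const L
  have hχ₂d : ContDiff ℝ 1 χ₂ :=
    (hS1.comp (((hcim.sub contDiff_const).sub contDiff_const).div_const ε)).mul
      (hS1.comp ((contDiff_const.sub hcim).div_const ε))
  have hθ₀d : ContDiff ℝ 1 fun z : ℂ × P ↦ ((ρ z * χ₂ z / 2 : ℝ) : ℂ) :=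
    ofRealCLM.contDiff.comp ((hρd.mul hχ₂d).div_const 2)
  have hθd : ContDiff ℝ 1 θ := hθ₀d.mul (hχd.comp contDiff_snd)
  have hΦ'd : ContDiff ℝ 1 fun z : ℂ × P ↦ r z * (χ₂ z : ℂ) * χ₃ z.2 :=
    (hrd.mul (ofRealCLM.contDiff.comp hχ₂d)).mul (hχd.comp contDiff_snd)
  have hΦ''d : ContDiff ℝ 1 fun z : ℂ × P ↦ (1 - r z) * (χ₂ z : ℂ) * χ₃ z.2 :=
    ((contDiff_const.sub hrd).mul (ofRealCLM.contDiff.comp hχ₂d)).mul (hχd.comp contDiff_snd)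
  have hfC1 : ContDiffOn ℝ 1 f D := (SCV.contDiffOn_one hf hDo).restrict_scalars ℝ
  have hfR : ∀ z ∈ D, DifferentiableAt ℝ f z := fun z hz ↦
    ((hf.differentiableAt (hDo.mem_nhds hz)).restrictScalars ℝ)
  have hfC : ∀ z ∈ D, DifferentiableAt ℂ f z := fun z hz ↦ hf.differentiableAt (hDo.mem_nhds hz)
  /- values of the cut-offs -/
  have hr0 : ∀ z : ℂ × P, z.1.re ≤ a' + δ → r z = 0 := fun z hz ↦ by
    simp only [hr, ofReal_eq_zero]
    exact Real.smoothTransition.zero_of_nonpos (div_nonpos_of_nonpos_of_nonneg (by linarith) hL0.le)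
  have hr1 : ∀ z : ℂ × P, b' - δ ≤ z.1.re → r z = 1 := fun z hz ↦ by
    simp only [hr, ofReal_eq_one]
    exact Real.smoothTransition.one_of_one_le ((one_le_div hL0).2 (by rw [hL]; linarith))
  have hρ0 : ∀ z : ℂ × P, z.1.re < a' + δ → ρ z = 0 := fun z hz ↦ by
    simp only [hρ, div_eq_zero_iff]
    refine Or.inl (deriv_smoothTransition_eq_zero_of_notMem_Icc fun hm ↦ ?_)
    exact absurd hm.1 (not_le.2 (div_neg_of_neg_of_pos (by linarith) hL0))
  have hρ0' : ∀ z : ℂ × P, b' - δ < z.1.re → ρ z = 0 := fun z hz ↦ by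
    simp only [hρ, div_eq_zero_iff]
    refine Or.inl (deriv_smoothTransition_eq_zero_of_notMem_Icc fun hm ↦ ?_)
    exact absurd hm.2 (not_le.2 ((one_lt_div hL0).2 (by rw [hL]; linarith)))
  have hρle : ∀ z : ℂ × P, |ρ z| ≤ M / L := fun z ↦ by
    simp only [hρ, abs_div, abs_of_pos hL0]
    exact div_le_div_of_nonneg_right (hM _) hL0.le
  have hχ₂one : ∀ z : ℂ × P, c + 2 * ε ≤ z.1.im → z.1.im ≤ d - 2 * ε → χ₂ z = 1 := by
    intro z h1 h2
    have e1 : Real.smoothTransition ((z.1.im - c - ε) / ε) = 1 :=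
      Real.smoothTransition.one_of_one_le ((one_le_div hε).2 (by linarith))
    have e2 : Real.smoothTransition ((d - ε - z.1.im) / ε) = 1 :=
      Real.smoothTransition.one_of_one_le ((one_le_div hε).2 (by linarith))
    simp only [hχ₂, e1, e2, mul_one]
  have hχ₂abs : ∀ z : ℂ × P, |χ₂ z| ≤ 1 := fun z ↦ by
    simp only [hχ₂, abs_mul]
    exact mul_le_one₀ ((abs_of_nonneg (Real.smoothTransition.nonneg _)).trans_le
      (Real.smoothTransition.le_one _)) (abs_nonneg _)
      ((abs_of_nonneg (Real.smoothTransition.nonneg _)).trans_le (Real.smoothTransition.le_one _))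
  have hrabs : ∀ z : ℂ × P, ‖r z‖ ≤ 1 := fun z ↦ by
    simp only [hr, norm_real, Real.norm_eq_abs]
    rw [abs_of_nonneg (Real.smoothTransition.nonneg _)]
    exact Real.smoothTransition.le_one _
  have hr1abs : ∀ z : ℂ × P, ‖1 - r z‖ ≤ 1 := fun z ↦ by
    have h0 : 0 ≤ 1 - Real.smoothTransition ((z.1.re - (a' + δ)) / L) := sub_nonneg.2 (Real.smoothTransition.le_one _)
    have h1 : 1 - Real.smoothTransition ((z.1.re - (a' + δ)) / L) ≤ 1 := by
      linarith [Real.smoothTransition.nonneg ((z.1.re - (a' + δ)) / L)]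
    simp only [hr]
    rw [show (1 : ℂ) - ((Real.smoothTransition ((z.1.re - (a' + δ)) / L) : ℝ) : ℂ) =
      ((1 - Real.smoothTransition ((z.1.re - (a' + δ)) / L) : ℝ) : ℂ) by push_cast; ring, norm_real, Real.norm_eq_abs,
      abs_of_nonneg h0]
    exact h1
  /- support of `θ` and `h` -/
  have hθsupp : ∀ w : ℂ × P, θ w ≠ 0 →
      (a' + δ ≤ w.1.re ∧ w.1.re ≤ b' - δ) ∧ (c + ε < w.1.im ∧ w.1.im < d - ε) ∧ χ₃ w.2 ≠ 0 := by
    intro w hw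
    obtain ⟨h12, h3⟩ := mul_ne_zero_iff.1 hw
    have h12' : ρ w * χ₂ w / 2 ≠ 0 := by exact_mod_cast h12
    have hρw : ρ w ≠ 0 := by
      intro h0; exact h12' (by rw [h0]; ring)
    have hχw : χ₂ w ≠ 0 := by
      intro h0; exact h12' (by rw [h0]; ring)
    refine ⟨⟨?_, ?_⟩, ⟨?_, ?_⟩, h3⟩
    · by_contra hlt
      exact hρw (hρ0 w (lt_of_not_ge hlt))
    · by_contra hlt
      exact hρw (hρ0' w (lt_of_not_ge hlt))
    · obtain ⟨hA, -⟩ := mul_ne_zero_iff.1 hχw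
      have : ¬ (w.1.im - c - ε) / ε ≤ 0 := fun hle ↦ hA (Real.smoothTransition.zero_of_nonpos hle)
      have := (div_pos_iff_of_pos_right hε).1 (lt_of_not_ge this)
      linarith
    · obtain ⟨-, hB⟩ := mul_ne_zero_iff.1 hχw
      have : ¬ (d - ε - w.1.im) / ε ≤ 0 := fun hle ↦ hB (Real.smoothTransition.zero_of_nonpos hle)
      have := (div_pos_iff_of_pos_right hε).1 (lt_of_not_ge this)
      linarith
  -- a compact set carrying `h`
  set K₁ : Set ℂ := {z₁ : ℂ | a' + δ ≤ z₁.re ∧ z₁.re ≤ b' - δ ∧ c + ε ≤ z₁.im ∧ z₁.im ≤ d - ε}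
    with hK₁
  have hK₁c : IsCompact K₁ := by
    refine Metric.isCompact_of_isClosed_isBounded ?_ ?_
    · simp only [hK₁, setOf_and]
      exact (isClosed_le continuous_const continuous_re).inter
        ((isClosed_le continuous_re continuous_const).inter
        ((isClosed_le continuous_const continuous_im).inter
        (isClosed_le continuous_im continuous_const)))
    · refine isBounded_iff_forall_norm_le.2 ⟨|a' + δ| + |b' - δ| + (|c + ε| + |d - ε|), ?_⟩
      rintro z₁ ⟨h1, h2, h3, h4⟩
      refine (norm_le_abs_re_add_abs_im z₁).trans (add_le_add ?_ ?_)
      · rcases le_or_gt 0 z₁.re with h | h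
        · rw [abs_of_nonneg h]; exact h2.trans ((le_abs_self _).trans (le_add_of_nonneg_left (abs_nonneg _)))
        · rw [abs_of_neg h]
          have : -z₁.re ≤ |a' + δ| := (neg_le_neg h1).trans (neg_le_abs _)
          exact this.trans (le_add_of_nonneg_right (abs_nonneg _))
      · rcases le_or_gt 0 z₁.im with h | h
        · rw [abs_of_nonneg h]; exact h4.trans ((le_abs_self _).trans (le_add_of_nonneg_left (abs_nonneg _)))
        · rw [abs_of_neg h]
          have : -z₁.im ≤ |c + ε| := (neg_le_neg h3).trans (neg_le_abs _)
          exact this.trans (le_add_of_nonneg_right (abs_nonneg _))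
  set A : Set (ℂ × P) := K₁ ×ˢ tsupport χ₃ with hA
  have hAc : IsCompact A := hK₁c.prod hχc
  have hAD : A ⊆ D := by
    rintro w ⟨⟨h1, h2, h3, h4⟩, h5⟩
    exact ⟨by linarith, by linarith, by linarith, by linarith, hχU h5⟩
  have hθA : ∀ w, θ w ≠ 0 → w ∈ A := fun w hw ↦ by
    obtain ⟨⟨h1, h2⟩, ⟨h3, h4⟩, h5⟩ := hθsupp w hw
    exact ⟨⟨h1, h2, h3.le, h4.le⟩, subset_tsupport _ h5⟩
  have hhA : ∀ w, w ∉ A → h w = 0 := fun w hw ↦ by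
    have : θ w = 0 := by_contra fun hne ↦ hw (hθA w hne)
    simp only [hh, this, zero_smul]
  have hhc : HasCompactSupport h := HasCompactSupport.intro hAc hhA
  have htθ : tsupport θ ⊆ D :=
    (closure_minimal (fun w hw ↦ hθA w hw) hAc.isClosed).trans hAD
  have hth : tsupport h ⊆ A :=
    closure_minimal (fun w hw ↦ by_contra fun hwA ↦ hw (hhA w hwA)) hAc.isClosed
  have hhd : ContDiff ℝ 1 h := contDiff_smul_of_tsupport_subset hDo hθd htθ hfC1
  /- the Cauchy transform `T = ĥ` -/
  have hTd : ContDiff ℝ 1 T := contDiff_cauchyTransformAlong hhd hhc he₁0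
  have hTR : ∀ z, DifferentiableAt ℝ T z := fun z ↦ (hTd.differentiable one_ne_zero) z
  have hT1 : ∀ z, dbarAlong e₁ T z = h z := fun z ↦ dbarAlong_cauchyTransformAlong hhd hhc he₁0 z
  -- `h` is holomorphic in the parameters over `U₁`, hence so is `T`
  have hh2 : ∀ w₀ : ℂ × P, w₀.2 ∈ U₁ → ∀ w : P, dbarAlong ((0 : ℂ), w) h w₀ = 0 := by
    intro w₀ hw₀ w
    by_cases hD₀ : w₀ ∈ D
    · have hev : h =ᶠ[𝓝 w₀] fun z ↦ (((ρ z * χ₂ z / 2 : ℝ) : ℂ)) • f z := by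
        filter_upwards [(hU₁.preimage continuous_snd).mem_nhds hw₀] with z hz
        simp only [hh, hθ, hχ1 z.2 hz, mul_one]
      rw [dbarAlong_congr_of_eventuallyEq hev,
        dbarAlong_smul ((hθ₀d.differentiable one_ne_zero) w₀) (hfR w₀ hD₀),
        dbarAlong_eq_zero_of_differentiableAt (hfC w₀ hD₀), smul_zero, add_zero]
      have key : dbarAlong ((0 : ℂ), w) (fun z : ℂ × P ↦ (((ρ z * χ₂ z / 2 : ℝ) : ℂ))) w₀ = 0 :=
        dbarAlong_zero_dir_eq_zero_of_fst
          (fun z₁ : ℂ ↦ (((deriv Real.smoothTransition ((z₁.re - (a' + δ)) / L) / L *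
            (Real.smoothTransition ((z₁.im - c - ε) / ε) * Real.smoothTransition ((d - ε - z₁.im) / ε)) / 2 : ℝ) : ℂ))) w w₀
      rw [key, zero_smul]
    · exact dbarAlong_eq_zero_of_eventuallyEq_zero
        (notMem_tsupport_iff_eventuallyEq.1 fun hmem ↦ hD₀ (hAD (hth hmem))) _
  have hT2 : ∀ z : ℂ × P, z.2 ∈ U₁ → ∀ w : P, dbarAlong ((0 : ℂ), w) T z = 0 := by
    intro z hz w
    refine dbarAlong_cauchyTransformAlong_eq_zero hhd hhc he₁0 fun t ↦ hh2 _ ?_ w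
    simpa [he₁] using hz
  /- the derivative of `r` in the `z₁`-direction -/
  have hrderiv : ∀ z : ℂ × P,
      HasDerivAt (fun x : ℝ ↦ Real.smoothTransition ((x - (a' + δ)) / L)) (ρ z) z.1.re := fun z ↦ by
    have h1 : HasDerivAt (fun x : ℝ ↦ (x - (a' + δ)) / L) (1 / L) z.1.re := by
      simpa using ((hasDerivAt_id z.1.re).sub_const (a' + δ)).div_const L
    have h2 : HasDerivAt Real.smoothTransition (deriv Real.smoothTransition ((z.1.re - (a' + δ)) / L)) ((z.1.re - (a' + δ)) / L) :=
      ((hS1.differentiable one_ne_zero) _).hasDerivAt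
    refine (h2.comp z.1.re h1).congr_deriv ?_
    show _ = deriv Real.smoothTransition ((z.1.re - (a' + δ)) / L) / L
    ring
  have hr_e1 : ∀ z : ℂ × P, dbarAlong e₁ r z = (ρ z : ℂ) / 2 := fun z ↦
    dbarAlong_e1_ofReal_re_fst (hrderiv z)
  have hr_0w : ∀ (z : ℂ × P) (w : P), dbarAlong ((0 : ℂ), w) r z = 0 := fun z w ↦
    dbarAlong_zero_dir_eq_zero_of_fst (fun z₁ : ℂ ↦ ((Real.smoothTransition ((z₁.re - (a' + δ)) / L) : ℝ) : ℂ)) w z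
  have h1r_e1 : ∀ z : ℂ × P, dbarAlong e₁ (fun y ↦ 1 - r y) z = -((ρ z : ℂ) / 2) := fun z ↦ by
    rw [dbarAlong_sub (differentiableAt_const _) ((hrd.differentiable one_ne_zero) z),
      dbarAlong_eq_zero_of_differentiableAt (differentiableAt_const _), hr_e1, zero_sub]
  have h1r_0w : ∀ (z : ℂ × P) (w : P), dbarAlong ((0 : ℂ), w) (fun y ↦ 1 - r y) z = 0 :=
    fun z w ↦ dbarAlong_zero_dir_eq_zero_of_fst
      (fun z₁ : ℂ ↦ 1 - ((Real.smoothTransition ((z₁.re - (a' + δ)) / L) : ℝ) : ℂ)) w z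
  /- the region where `χ₂ = χ₃ = 1` -/
  have hgood : ∀ z : ℂ × P, c + 2 * ε < z.1.im → z.1.im < d - 2 * ε → z.2 ∈ U₁ →
      ∀ᶠ w in 𝓝 z, χ₂ w = 1 ∧ χ₃ w.2 = 1 := by
    intro z h1 h2 h3
    have him : Continuous fun w : ℂ × P ↦ w.1.im := continuous_im.comp continuous_fst
    have ho : IsOpen {w : ℂ × P | c + 2 * ε < w.1.im ∧ w.1.im < d - 2 * ε ∧ w.2 ∈ U₁} := by
      simp only [setOf_and]
      exact (isOpen_lt continuous_const him).inter ((isOpen_lt him continuous_const).inter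
        (hU₁.preimage continuous_snd))
    filter_upwards [ho.mem_nhds ⟨h1, h2, h3⟩] with w hw
    exact ⟨hχ₂one w hw.1.le hw.2.1.le, hχ1 w.2 hw.2.2⟩
  /- holomorphy of `f' = p - T` on `B'₁` -/
  have hp_hol : ∀ z : ℂ × P, z.1.re < b' → c + 2 * ε < z.1.im → z.1.im < d - 2 * ε →
      z.2 ∈ U₁ → DifferentiableAt ℝ p z ∧ dbarAlong e₁ p z = h z ∧
        ∀ w : P, dbarAlong ((0 : ℂ), w) p z = 0 := by
    intro z hx hy1 hy2 hz2
    by_cases hxa : z.1.re < a' + δ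
    · -- `p = 0` near `z` and `h z = 0`
      have hev : p =ᶠ[𝓝 z] fun _ ↦ 0 := by
        have hre : Continuous fun w : ℂ × P ↦ w.1.re := continuous_re.comp continuous_fst
        filter_upwards [(isOpen_lt hre continuous_const).mem_nhds hxa] with w hw
        simp only [hp, hr0 w (le_of_lt hw), zero_mul, zero_smul]
      have hhz : h z = 0 := by simp only [hh, hθ, hρ0 z hxa, zero_mul, zero_div, ofReal_zero,
        zero_smul]
      refine ⟨(differentiableAt_const _).congr_of_eventuallyEq hev, ?_, fun w ↦ ?_⟩
      · rw [dbarAlong_congr_of_eventuallyEq hev, hhz]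
        exact dbarAlong_eq_zero_of_differentiableAt (differentiableAt_const _) _
      · rw [dbarAlong_congr_of_eventuallyEq hev]
        exact dbarAlong_eq_zero_of_differentiableAt (differentiableAt_const _) _
    · -- `z ∈ D` and `p = r • f` near `z`
      have hzD : z ∈ D := ⟨by linarith, hx, by linarith, by linarith, hU₁U hz2⟩
      have hev : p =ᶠ[𝓝 z] fun w ↦ r w • f w := by
        filter_upwards [hgood z hy1 hy2 hz2] with w hw
        simp only [hp, hw.1, hw.2, ofReal_one, mul_one]
      have hrz : DifferentiableAt ℝ r z := (hrd.differentiable one_ne_zero) z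
      refine ⟨((hΦ'd.differentiable one_ne_zero) z).smul (hfR z hzD), ?_, fun w ↦ ?_⟩
      · rw [dbarAlong_congr_of_eventuallyEq hev, dbarAlong_smul hrz (hfR z hzD),
          dbarAlong_eq_zero_of_differentiableAt (hfC z hzD), smul_zero, add_zero, hr_e1]
        obtain ⟨hc2, hc3⟩ := (hgood z hy1 hy2 hz2).self_of_nhds
        simp only [hh, hθ, hc2, hc3, mul_one]
        push_cast
        ring_nf
      · rw [dbarAlong_congr_of_eventuallyEq hev, dbarAlong_smul hrz (hfR z hzD),
          dbarAlong_eq_zero_of_differentiableAt (hfC z hzD), smul_zero, add_zero, hr_0w,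
          zero_smul]
  /- holomorphy of `f'' = q + T` on `B''₁` -/
  have hq_hol : ∀ z : ℂ × P, a' < z.1.re → c + 2 * ε < z.1.im → z.1.im < d - 2 * ε →
      z.2 ∈ U₁ → DifferentiableAt ℝ q z ∧ dbarAlong e₁ q z = -h z ∧
        ∀ w : P, dbarAlong ((0 : ℂ), w) q z = 0 := by
    intro z hx hy1 hy2 hz2
    by_cases hxb : b' - δ < z.1.re
    · -- `q = 0` near `z` and `h z = 0`
      have hev : q =ᶠ[𝓝 z] fun _ ↦ 0 := by
        have hre : Continuous fun w : ℂ × P ↦ w.1.re := continuous_re.comp continuous_fst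
        filter_upwards [(isOpen_lt continuous_const hre).mem_nhds hxb] with w hw
        simp only [hq, hr1 w (le_of_lt hw), sub_self, zero_mul, zero_smul]
      have hhz : h z = 0 := by simp only [hh, hθ, hρ0' z hxb, zero_mul, zero_div, ofReal_zero,
        zero_smul]
      refine ⟨(differentiableAt_const _).congr_of_eventuallyEq hev, ?_, fun w ↦ ?_⟩
      · rw [dbarAlong_congr_of_eventuallyEq hev, hhz, neg_zero]
        exact dbarAlong_eq_zero_of_differentiableAt (differentiableAt_const _) _
      · rw [dbarAlong_congr_of_eventuallyEq hev]
        exact dbarAlong_eq_zero_of_differentiableAt (differentiableAt_const _) _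
    · have hzD : z ∈ D := ⟨hx, by linarith, by linarith, by linarith, hU₁U hz2⟩
      have hev : q =ᶠ[𝓝 z] fun w ↦ (1 - r w) • f w := by
        filter_upwards [hgood z hy1 hy2 hz2] with w hw
        simp only [hq, hw.1, hw.2, ofReal_one, mul_one]
      have h1rz : DifferentiableAt ℝ (fun y ↦ 1 - r y) z :=
        (differentiableAt_const _).sub ((hrd.differentiable one_ne_zero) z)
      refine ⟨((hΦ''d.differentiable one_ne_zero) z).smul (hfR z hzD), ?_, fun w ↦ ?_⟩
      · rw [dbarAlong_congr_of_eventuallyEq hev, dbarAlong_smul h1rz (hfR z hzD),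
          dbarAlong_eq_zero_of_differentiableAt (hfC z hzD), smul_zero, add_zero, h1r_e1]
        obtain ⟨hc2, hc3⟩ := (hgood z hy1 hy2 hz2).self_of_nhds
        simp only [hh, hθ, hc2, hc3, mul_one, neg_smul]
        push_cast
        ring_nf
      · rw [dbarAlong_congr_of_eventuallyEq hev, dbarAlong_smul h1rz (hfR z hzD),
          dbarAlong_eq_zero_of_differentiableAt (hfC z hzD), smul_zero, add_zero, h1r_0w,
          zero_smul]
  /- the bound on `T` -/
  have hTle : ∀ z : ℂ × P, a < z.1.re → z.1.re < b → c < z.1.im → z.1.im < d →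
      ‖T z‖ ≤ 2 * R * (M / L / 2 * N) := by
    intro z h1 h2 h3 h4
    refine norm_cauchyTransformAlong_le hR0.le (by positivity) (fun t ht ↦ ?_) (fun t ↦ ?_)
    · -- support radius
      have hne : θ (z - t • e₁) ≠ 0 := by
        intro h0; apply ht; simp only [hh, h0, zero_smul]
      obtain ⟨⟨q1, q2⟩, ⟨q3, q4⟩, -⟩ := hθsupp _ hne
      simp only [he₁, Prod.fst_sub, Prod.smul_mk, smul_eq_mul, mul_one, sub_re, sub_im] at q1 q2 q3 q4
      refine (norm_le_abs_re_add_abs_im t).trans_lt ?_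
      have ha : |t.re| ≤ b - a := abs_le.2 ⟨by linarith, by linarith⟩
      have hb : |t.im| ≤ Δ :=
        ((abs_le.2 ⟨by linarith, by linarith⟩).trans (le_abs_self _)).trans hΔ
      rw [hR]; linarith
    · -- sup bound of `h`
      by_cases h0 : θ (z - t • e₁) = 0
      · simp only [hh, h0, zero_smul, norm_zero]; positivity
      · obtain ⟨⟨q1, q2⟩, ⟨q3, q4⟩, q5⟩ := hθsupp _ h0
        have hwD : z - t • e₁ ∈ D := hAD (hθA _ h0)
        obtain ⟨d1, d2, d3, d4, d5⟩ := hwD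
        simp only [hh, norm_smul]
        have hfle := hfN (z - t • e₁) d1 d2 d3 d4 d5
        have hθle : ‖θ (z - t • e₁)‖ ≤ M / L / 2 := by
          simp only [hθ, norm_mul, norm_real, Real.norm_eq_abs]
          calc |ρ (z - t • e₁) * χ₂ (z - t • e₁) / 2| * ‖χ₃ (z - t • e₁).2‖
              ≤ (M / L * 1 / 2) * 1 := by
                rw [abs_div, abs_mul, abs_two]
                gcongr
                · exact hρle _
                · exact hχ₂abs _
                · exact hχle _
            _ = M / L / 2 := by ring
        calc ‖θ (z - t • e₁)‖ * ‖f (z - t • e₁)‖ ≤ (M / L / 2) * N := by gcongr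
          _ = M / L / 2 * N := rfl
  have hple : ∀ z : ℂ × P, z.1.re < b' → c < z.1.im → z.1.im < d → ‖p z‖ ≤ N := by
    intro z h2 h3 h4
    by_cases h0 : χ₃ z.2 = 0
    · simp only [hp, h0, mul_zero, zero_smul, norm_zero]; exact hN
    by_cases hxa : z.1.re ≤ a' + δ
    · simp only [hp, hr0 z hxa, zero_mul, zero_smul, norm_zero]; exact hN
    have hzU : z.2 ∈ U := hχU (subset_tsupport _ h0)
    have hfle := hfN z (by linarith) h2 h3 h4 hzU
    simp only [hp, norm_smul, norm_mul, norm_real, Real.norm_eq_abs]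
    calc ‖r z‖ * |χ₂ z| * ‖χ₃ z.2‖ * ‖f z‖ ≤ 1 * 1 * 1 * N := by
          gcongr
          · exact hrabs z
          · exact hχ₂abs z
          · exact hχle _
      _ = N := by ring
  have hqle : ∀ z : ℂ × P, a' < z.1.re → c < z.1.im → z.1.im < d → ‖q z‖ ≤ N := by
    intro z h1 h3 h4
    by_cases h0 : χ₃ z.2 = 0
    · simp only [hq, h0, mul_zero, zero_smul, norm_zero]; exact hN
    by_cases hxb : b' - δ ≤ z.1.re
    · simp only [hq, hr1 z hxb, sub_self, zero_mul, zero_smul, norm_zero]; exact hN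
    have hzU : z.2 ∈ U := hχU (subset_tsupport _ h0)
    have hfle := hfN z h1 (by linarith) h3 h4 hzU
    simp only [hq, norm_smul, norm_mul, norm_real, Real.norm_eq_abs]
    calc ‖1 - r z‖ * |χ₂ z| * ‖χ₃ z.2‖ * ‖f z‖ ≤ 1 * 1 * 1 * N := by
          gcongr
          · exact hr1abs z
          · exact hχ₂abs z
          · exact hχle _
      _ = N := by ring
  have hKN : N + 2 * R * (M / L / 2 * N) = (1 + R * M / L) * N := by ring
  /- assembly -/
  refine ⟨fun z ↦ p z - T z, fun z ↦ q z + T z, ?_, ?_, ?_, ?_, ?_⟩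
  · rintro z ⟨hx, hy1, hy2, hz2⟩
    obtain ⟨hpR, hp1, hp2⟩ := hp_hol z hx hy1 hy2 hz2
    have hd : DifferentiableAt ℝ (fun y ↦ p y - T y) z := hpR.sub (hTR z)
    refine (differentiableAt_complex_of_dbarAlong_prod hd ?_ fun w ↦ ?_).differentiableWithinAt
    · rw [dbarAlong_sub hpR (hTR z), hp1, hT1, sub_self]
    · rw [dbarAlong_sub hpR (hTR z), hp2, hT2 z hz2, sub_self]
  · rintro z ⟨hx, hy1, hy2, hz2⟩
    obtain ⟨hqR, hq1, hq2⟩ := hq_hol z hx hy1 hy2 hz2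
    have hd : DifferentiableAt ℝ (fun y ↦ q y + T y) z := hqR.add (hTR z)
    refine (differentiableAt_complex_of_dbarAlong_prod hd ?_ fun w ↦ ?_).differentiableWithinAt
    · rw [dbarAlong_fun_add hqR (hTR z), hq1, hT1, neg_add_cancel]
    · rw [dbarAlong_fun_add hqR (hTR z), hq2, hT2 z hz2, add_zero]
  · intro z hx1 hx2 hy1 hy2 hz2
    have hc2 : χ₂ z = 1 := hχ₂one z hy1.le hy2.le
    have hc3 : χ₃ z.2 = 1 := hχ1 z.2 hz2
    rw [sub_add_add_cancel]
    simp only [hp, hq, hc2, hc3, ofReal_one, mul_one, ← add_smul, add_sub_cancel, one_smul]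
  · intro z h1 h2 h3 h4
    calc ‖p z - T z‖ ≤ ‖p z‖ + ‖T z‖ := norm_sub_le _ _
      _ ≤ N + 2 * R * (M / L / 2 * N) :=
          add_le_add (hple z h2 h3 h4) (hTle z h1 (by linarith) h3 h4)
      _ = (1 + R * M / L) * N := hKN
  · intro z h1 h2 h3 h4
    calc ‖q z + T z‖ ≤ ‖q z‖ + ‖T z‖ := norm_add_le _ _
      _ ≤ N + 2 * R * (M / L / 2 * N) :=
          add_le_add (hqle z h1 h3 h4) (hTle z (by linarith) h2 h3 h4)
      _ = (1 + R * M / L) * N := hKN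

end Cousin

end Literature.Analysis.Complex

end
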